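import Summits.KontsevichZagierPeriods.Zeta5Search.Certificates.RecordRayDenominatorsBrickAtlas
import Summits.KontsevichZagierPeriods.Zeta5Search.RecordCell1516
import HarnessLib

/-!
# ζ(5) search — the record ray's DENOMINATORS, XI-c: a third window source (law M on `(15n,16n]`) and SOUND window lists (p3 g5)

HONEST FRAMING: systematic search; no irrationality claim unless certified.

OUR work (Summit side; prover seat p3, generation 5).  Files XI-a/XI-b consume two window sources (atlas33 sub-windows and
fam-denom's brick cells) through the Boolean check `BWin.ok`.  This file adds

* the window lemma `wLaw1516`: on `(15n, 16n]` the class bound `Cell1516.recordCell1516` (`v_p(Cas₇) ≥ −3`, law M by name)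
  gives exponent `4` through `cell_core` (`v_p(N♯) = −1`, `v_p(ρ) = 2`; the kernel had `3` from the `(WV)`-law);
* the source kind `2` (`BWin.okLaw`: window inside `(15n,16n]`, `k ≤ 4`) and the extended check `BWin.ok2 = ok ∨ (okShape ∧ okLaw)`
  with its soundness;
* the list-level atlas theorems of file XI-b restated over an ABSTRACT soundness hypothesis (`BWin.Sound`: shape + divisibility
  for every prime of the window), so that any future source only has to supply `check ⇒ Sound`: `record_exponent_of_sound`,
  and the instance `record_exponent_of_table2` for lists checked by `ok2`.

Valuation bookkeeping; every `γ < 1` — no irrationality content.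
-/

noncomputable section

open Finset Real Filter Topology

namespace Summit.KontsevichZagierPeriods.Zeta5Search.RecordRay

open Summit.KontsevichZagierPeriods.Zeta5Search.DualSeries
open Summit.KontsevichZagierPeriods.Zeta5Search.DualSeriesDenominators
open Summit.KontsevichZagierPeriods.Zeta5Search.WedgeDictionary
open Summit.KontsevichZagierPeriods.Zeta5Search.DualSeriesLemma19 (bRecord)
open Summit.KontsevichZagierPeriods.Zeta5Search.CasoratianValuation (casoratian shift)
open Literature.NumberTheory.Irrationality.Hata1992
open Literature.NumberTheory.Transcendental (zetaValue)

/-! ### The law-M window `(15n, 16n]` -/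

section Window

variable {n p : ℕ}

/-- LAW-M window `(15n, 16n]`: `Cell1516.recordCell1516` (`−3 ≤ v_p(Cas₇)`, PROVED), `v_p(N♯) = −1`, `v_p(ρ) = 2`,
exponent `4` (`= min(9 − 2 − 3, 9 − 2 − 2)`). -/
theorem wLaw1516 (hn : 47 ≤ n) (hp : p.Prime) (hlo : 15 * n < p) (hhi : p ≤ 16 * n)
    {zW zV zW' zV' zU zU' : ℤ}
    (hzW : dRec n ^ 3 * sharpNormaliser (bRecord n) * coeffW (bRecord n) = zW)
    (hzV : dRec n ^ 6 * sharpNormaliser (bRecord n) * coeffV (bRecord n) = zV)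
    (hzW' : dRec n ^ 3 * sharpNormaliser (bRecord' n) * coeffW (bRecord' n) = zW')
    (hzV' : dRec n ^ 6 * sharpNormaliser (bRecord' n) * coeffV (bRecord' n) = zV')
    (hzU : dRec n * sharpNormaliser (bRecord n) * coeffU (bRecord n) = zU)
    (hzU' : dRec n * sharpNormaliser (bRecord' n) * coeffU (bRecord' n) = zU') :
    (p : ℤ) ^ 4 ∣ (zW' * zV - zW * zV') ∧
    (p : ℤ) ^ 4 ∣ ((Nat.lcmUpto (41 * n) : ℤ) ^ 5 * (zU * zW') - (Nat.lcmUpto (41 * n) : ℤ) ^ 5 * (zU' * zW)) := by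
  have hn1 : 1 ≤ n := by omega
  have hnp : n < p := by omega
  have hp41 : p ≤ 41 * n := by omega
  have hsq : 41 * n < p ^ 2 := by nlinarith
  have hhi' : p < 16 * n := by
    rcases hhi.lt_or_eq with h | h
    · exact h
    · exfalso
      have h2 : 2 ∣ p := ⟨8 * n, by omega⟩
      have := (Nat.prime_dvd_prime_iff_eq Nat.prime_two hp).1 h2
      omega
  have e8 : 8 * n / p = 0 := Nat.div_eq_of_lt_le (by omega) (by omega)
  have e9 : 9 * n / p = 0 := Nat.div_eq_of_lt_le (by omega) (by omega)
  have e10 : 10 * n / p = 0 := Nat.div_eq_of_lt_le (by omega) (by omega)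
  have e11 : 11 * n / p = 0 := Nat.div_eq_of_lt_le (by omega) (by omega)
  have e12 : 12 * n / p = 0 := Nat.div_eq_of_lt_le (by omega) (by omega)
  have e13 : 13 * n / p = 0 := Nat.div_eq_of_lt_le (by omega) (by omega)
  have e14 : 14 * n / p = 0 := Nat.div_eq_of_lt_le (by omega) (by omega)
  have e15 : 15 * n / p = 0 := Nat.div_eq_of_lt_le (by omega) (by omega)
  have e16 : 16 * n / p = 1 := Nat.div_eq_of_lt_le (by omega) (by omega)
  have e17 : 17 * n / p = 1 := Nat.div_eq_of_lt_le (by omega) (by omega)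
  have e18 : 18 * n / p = 1 := Nat.div_eq_of_lt_le (by omega) (by omega)
  have e25 : 25 * n / p = 1 := Nat.div_eq_of_lt_le (by omega) (by omega)
  have hvN : padicValRat p (sharpNormaliser (bRecord n)) = -1 := by
    rw [padicValRat_sharpNormaliser_bRecord hp (by omega), e12, e13, e14, e15, e16]; norm_num
  have hvN' : padicValRat p (sharpNormaliser (bRecord' n)) = -1 := by
    rw [padicValRat_sharpNormaliser_bRecord' hn1 hp hnp (by omega) (by omega), e12, e13, e14, e15, e16]; norm_num
  have hvr : padicValRat p (rhoOf (aRec n)) = 2 := by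
    rw [padicValRat_rhoOf_aRec hp (by omega) (by omega), e8, e9, e10, e11, e12, e13, e14, e15, e16, e17, e18, e25]
    norm_num
  have hcas : casoratian (bRecord n) 7 ≠ 0 → (-3 : ℤ) ≤ padicValRat p (casoratian (bRecord n) 7) := by
    intro hne
    rw [bRecord_eq_bRec] at hne ⊢
    exact Cell1516.recordCell1516 n p hn1 hp hlo hhi' hne
  exact cell_core hn1 hp hp41 hsq hvN hvN' hvr hcas (k := 4) (by norm_num) (by norm_num) hzW hzV hzW' hzV' hzU hzU'

end Window

namespace BWin

/-- Source check, kind `2`: a sub-window of the law-M window `(15n, 16n]` with `k ≤ 4`. -/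
def okLaw (w : BWin) : Bool :=
  (w.kind == 2) && decide (15 * w.a2 ≤ w.a1) && decide (w.b1 ≤ 16 * w.b2) && decide (w.k ≤ 4)

/-- The extended check: `ok` (kinds 0, 1) or a shape-checked law window (kind 2). -/
def ok2 (w : BWin) : Bool := w.ok || (w.okShape && w.okLaw)

/-- **Soundness of a window** (abstract): for every `n ≥ 10496` and every prime with `a₁n < a₂p`, `b₂p ≤ b₁n`, `p^k` divides
the multiplied wedge and the multiplied Q-minor. -/
def Sound (w : BWin) : Prop :=
  ∀ ⦃n p : ℕ⦄, 10496 ≤ n → p.Prime → w.a1 * n < w.a2 * p → w.b2 * p ≤ w.b1 * n →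
    ∀ ⦃zW zV zW' zV' zU zU' : ℤ⦄,
      dRec n ^ 3 * sharpNormaliser (bRecord n) * coeffW (bRecord n) = zW →
      dRec n ^ 6 * sharpNormaliser (bRecord n) * coeffV (bRecord n) = zV →
      dRec n ^ 3 * sharpNormaliser (bRecord' n) * coeffW (bRecord' n) = zW' →
      dRec n ^ 6 * sharpNormaliser (bRecord' n) * coeffV (bRecord' n) = zV' →
      dRec n * sharpNormaliser (bRecord n) * coeffU (bRecord n) = zU →
      dRec n * sharpNormaliser (bRecord' n) * coeffU (bRecord' n) = zU' →
        (p : ℤ) ^ w.k ∣ (zW' * zV - zW * zV') ∧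
        (p : ℤ) ^ w.k ∣ ((Nat.lcmUpto (41 * n) : ℤ) ^ 5 * (zU * zW') - (Nat.lcmUpto (41 * n) : ℤ) ^ 5 * (zU' * zW))

/-- `ok ⇒ Sound` (file XI-a). -/
theorem sound_of_ok {w : BWin} (h : w.ok = true) : w.Sound :=
  fun _ _ hn hp hlo hhi _ _ _ _ _ _ hzW hzV hzW' hzV' hzU hzU' => dvd_of_ok h hn hp hlo hhi hzW hzV hzW' hzV' hzU hzU'

/-- `okLaw ⇒ Sound` (the law-M window). -/
theorem sound_of_okLaw {w : BWin} (hs : w.okShape = true) (h : w.okLaw = true) : w.Sound := by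
  intro n p hn hp hlo hhi zW zV zW' zV' zU zU' hzW hzV hzW' hzV' hzU hzU'
  simp only [okLaw, Bool.and_eq_true, beq_iff_eq, decide_eq_true_eq] at h
  obtain ⟨⟨⟨-, hA⟩, hB⟩, hk⟩ := h
  simp only [okShape, Bool.and_eq_true, decide_eq_true_eq] at hs
  obtain ⟨⟨⟨⟨⟨ha1, ha2⟩, hb2⟩, -⟩, -⟩, -⟩ := hs
  have hlo' : 15 * n < p := by
    have h1 : 15 * w.a2 * n ≤ w.a1 * n := Nat.mul_le_mul_right _ hA
    have h2 : w.a2 * (15 * n) < w.a2 * p := by nlinarith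
    exact Nat.lt_of_mul_lt_mul_left h2
  have hhi' : p ≤ 16 * n := by
    have h2 : w.b2 * p ≤ w.b2 * (16 * n) := by nlinarith
    exact Nat.le_of_mul_le_mul_left h2 hb2
  obtain ⟨d1, d2⟩ := wLaw1516 (by omega) hp hlo' hhi' hzW hzV hzW' hzV' hzU hzU'
  exact ⟨(pow_dvd_pow _ hk).trans d1, (pow_dvd_pow _ hk).trans d2⟩

/-- `ok2 ⇒ okShape`. -/
theorem okShape_of_ok2 {w : BWin} (h : w.ok2 = true) : w.okShape = true := by
  simp only [ok2, Bool.or_eq_true, Bool.and_eq_true] at h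
  rcases h with h | ⟨hs, -⟩
  · simp only [ok, Bool.and_eq_true] at h; exact h.1
  · exact hs

/-- `ok2 ⇒ Sound`. -/
theorem sound_of_ok2 {w : BWin} (h : w.ok2 = true) : w.Sound := by
  have h' := h
  simp only [ok2, Bool.or_eq_true, Bool.and_eq_true] at h'
  rcases h' with h1 | ⟨hs, hl⟩
  · exact sound_of_ok h1
  · exact sound_of_okLaw hs hl

/-- A shape-checked window has `0 ≤ A ≤ B` (over `ℝ`). -/
theorem Aq_le_Bq_of_okShape {w : BWin} (h : w.okShape = true) : (0 : ℝ) ≤ (w.Aq : ℝ) ∧ ((w.Aq : ℝ) : ℝ) ≤ (w.Bq : ℝ) := by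
  simp only [okShape, Bool.and_eq_true, decide_eq_true_eq] at h
  obtain ⟨⟨⟨⟨⟨-, ha2⟩, hb2⟩, hab⟩, -⟩, -⟩ := h
  have ha2' : (0 : ℝ) < w.a2 := by exact_mod_cast ha2
  have hb2' : (0 : ℝ) < w.b2 := by exact_mod_cast hb2
  have hab' : (w.a1 : ℝ) * w.b2 ≤ w.b1 * w.a2 := by exact_mod_cast hab
  unfold Aq Bq
  push_cast
  exact ⟨by positivity, by rw [div_le_div_iff₀ ha2' hb2']; linarith⟩

/-- Integer form of `A·n < p` for a shape-checked window. -/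
theorem lo_nat_of_okShape {w : BWin} {n p : ℕ} (h : w.okShape = true) (h1 : ((w.Aq : ℚ) : ℝ) * n < p) :
    w.a1 * n < w.a2 * p := by
  simp only [okShape, Bool.and_eq_true, decide_eq_true_eq] at h
  obtain ⟨⟨⟨⟨⟨-, ha2⟩, -⟩, -⟩, -⟩, -⟩ := h
  have ha2' : (0 : ℝ) < w.a2 := by exact_mod_cast ha2
  unfold Aq at h1
  push_cast at h1
  rw [div_mul_eq_mul_div, div_lt_iff₀ ha2'] at h1
  have : (w.a1 : ℝ) * n < w.a2 * p := by linarith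
  exact_mod_cast this

/-- Integer form of `p ≤ B·n` for a shape-checked window. -/
theorem hi_nat_of_okShape {w : BWin} {n p : ℕ} (h : w.okShape = true) (h2 : (p : ℝ) ≤ ((w.Bq : ℚ) : ℝ) * n) :
    w.b2 * p ≤ w.b1 * n := by
  simp only [okShape, Bool.and_eq_true, decide_eq_true_eq] at h
  obtain ⟨⟨⟨⟨⟨-, -⟩, hb2⟩, -⟩, -⟩, -⟩ := h
  have hb2' : (0 : ℝ) < w.b2 := by exact_mod_cast hb2
  unfold Bq at h2
  push_cast at h2
  rw [div_mul_eq_mul_div, le_div_iff₀ hb2'] at h2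
  have : (w.b2 : ℝ) * p ≤ w.b1 * n := by linarith
  exact_mod_cast this

end BWin

/-! ### Atlases from SOUND window lists (abstract form of file XI-b) -/

namespace BrickAtlas

variable {l : List BWin}

/-- Shape + soundness of every window of the list: the abstract hypothesis of this section. -/
def SoundList (l : List BWin) : Prop := ∀ i : Fin l.length, (l[i]).okShape = true ∧ (l[i]).Sound

/-- A list checked by `ok2` is sound. -/
theorem soundList_of_all_ok2 (hok : l.all BWin.ok2 = true) : SoundList l := fun i =>
  have h := List.all_eq_true.1 hok _ (List.getElem_mem i.isLt)
  ⟨BWin.okShape_of_ok2 h, BWin.sound_of_ok2 h⟩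

/-- `ok`-checked lists are `ok2`-checked. -/
theorem all_ok2_of_all_ok (hok : l.all BWin.ok = true) : l.all BWin.ok2 = true := by
  rw [List.all_eq_true] at hok ⊢
  intro w hw
  have := hok w hw
  simp only [BWin.ok2, Bool.or_eq_true]
  exact Or.inl this

/-- `0 ≤ A_i ≤ B_i` for a sound list. -/
theorem AL_le_BL_s (hS : SoundList l) :
    ∀ i ∈ (univ : Finset (Fin l.length)), 0 ≤ AL l i ∧ AL l i ≤ BL l i :=
  fun i _ => BWin.Aq_le_Bq_of_okShape (hS i).1

/-- `B_i ≤ A_{i+1}` over `ℝ` for a sound, chain-separated list. -/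
theorem BL_le_AL_succ_s (hS : SoundList l) (hch : chainSep l = true) (i : ℕ) (hi : i + 1 < l.length) :
    BL l ⟨i, by omega⟩ ≤ AL l ⟨i + 1, hi⟩ := by
  have hs := chainSep_succ hch i hi
  have h1 := (hS ⟨i, by omega⟩).1
  have h2 := (hS ⟨i + 1, hi⟩).1
  simp only [BWin.okShape, Bool.and_eq_true, decide_eq_true_eq] at h1 h2
  obtain ⟨⟨⟨⟨⟨-, -⟩, hb2⟩, -⟩, -⟩, -⟩ := h1
  obtain ⟨⟨⟨⟨⟨-, ha2⟩, -⟩, -⟩, -⟩, -⟩ := h2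
  unfold BL AL BWin.Bq BWin.Aq
  simp only [Fin.getElem_fin]
  push_cast
  rw [div_le_div_iff₀ (by exact_mod_cast hb2) (by exact_mod_cast ha2)]
  exact_mod_cast hs

/-- Separation of all pairs `i < j` for a sound, chain-separated list. -/
theorem BL_le_AL_s (hS : SoundList l) (hch : chainSep l = true) :
    ∀ (d i : ℕ) (hj : i + 1 + d < l.length), BL l ⟨i, by omega⟩ ≤ AL l ⟨i + 1 + d, hj⟩ := by
  intro d
  induction d with
  | zero => intro i hj; exact BL_le_AL_succ_s hS hch i hj
  | succ d ih =>
      intro i hj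
      have h1 := ih i (by omega)
      have h2 := (AL_le_BL_s hS ⟨i + 1 + d, by omega⟩ (mem_univ _)).2
      have h3 := BL_le_AL_succ_s hS hch (i + 1 + d) (by simpa [Nat.add_assoc] using hj)
      have e : (⟨i + 1 + d + 1, by simpa [Nat.add_assoc] using hj⟩ : Fin l.length) = ⟨i + 1 + (d + 1), hj⟩ :=
        Fin.ext (by simp [Nat.add_assoc])
      rw [e] at h3
      linarith

/-- The windows of a sound, chain-separated list are pairwise disjoint prime sets. -/
theorem disjointL_s (hS : SoundList l) (hch : chainSep l = true) (n : ℕ) :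
    ∀ i ∈ (univ : Finset (Fin l.length)), ∀ j ∈ (univ : Finset (Fin l.length)), i ≠ j →
      Disjoint (windowPrimes (AL l i) (BL l i) n) (windowPrimes (AL l j) (BL l j) n) := by
  intro i _ j _ hij
  rw [Finset.disjoint_left]
  intro p hpi hpj
  obtain ⟨-, a1, b1⟩ := (mem_windowPrimes_iff (AL_le_BL_s hS i (mem_univ _)).1).1 hpi
  obtain ⟨-, a2, b2⟩ := (mem_windowPrimes_iff (AL_le_BL_s hS j (mem_univ _)).1).1 hpj
  have hn : (0 : ℝ) ≤ n := Nat.cast_nonneg n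
  rcases lt_or_gt_of_ne (Fin.val_ne_of_ne hij) with h | h
  · obtain ⟨d, hd⟩ : ∃ d, j.val = i.val + 1 + d := ⟨j.val - i.val - 1, by omega⟩
    have hsep := BL_le_AL_s hS hch d i.val (by rw [← hd]; exact j.isLt)
    have e1 : (⟨i.val, by omega⟩ : Fin l.length) = i := Fin.ext rfl
    have e2 : (⟨i.val + 1 + d, by rw [← hd]; exact j.isLt⟩ : Fin l.length) = j := Fin.ext hd.symm
    rw [e1, e2] at hsep
    nlinarith [mul_le_mul_of_nonneg_right hsep hn]
  · obtain ⟨d, hd⟩ : ∃ d, i.val = j.val + 1 + d := ⟨i.val - j.val - 1, by omega⟩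
    have hsep := BL_le_AL_s hS hch d j.val (by rw [← hd]; exact i.isLt)
    have e1 : (⟨j.val, by omega⟩ : Fin l.length) = j := Fin.ext rfl
    have e2 : (⟨j.val + 1 + d, by rw [← hd]; exact i.isLt⟩ : Fin l.length) = i := Fin.ext hd.symm
    rw [e1, e2] at hsep
    nlinarith [mul_le_mul_of_nonneg_right hsep hn]

/-- The window divisibilities of a sound list (`n ≥ 10496`). -/
theorem dvdL_s (hS : SoundList l) {n : ℕ} (hn : 10496 ≤ n)
    {zW zV zW' zV' zU zU' : ℤ}
    (hzW : dRec n ^ 3 * sharpNormaliser (bRecord n) * coeffW (bRecord n) = zW)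
    (hzV : dRec n ^ 6 * sharpNormaliser (bRecord n) * coeffV (bRecord n) = zV)
    (hzW' : dRec n ^ 3 * sharpNormaliser (bRecord' n) * coeffW (bRecord' n) = zW')
    (hzV' : dRec n ^ 6 * sharpNormaliser (bRecord' n) * coeffV (bRecord' n) = zV')
    (hzU : dRec n * sharpNormaliser (bRecord n) * coeffU (bRecord n) = zU)
    (hzU' : dRec n * sharpNormaliser (bRecord' n) * coeffU (bRecord' n) = zU') :
    ∀ i ∈ (univ : Finset (Fin l.length)), ∀ p ∈ windowPrimes (AL l i) (BL l i) n,
      ((p : ℤ) ^ kL l i ∣ (zW' * zV - zW * zV')) ∧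
      ((p : ℤ) ^ kL l i ∣ ((Nat.lcmUpto (41 * n) : ℤ) ^ 5 * (zU * zW') - (Nat.lcmUpto (41 * n) : ℤ) ^ 5 * (zU' * zW))) := by
  intro i _ p hp
  obtain ⟨hshape, hsound⟩ := hS i
  obtain ⟨hpr, h1, h2⟩ := (mem_windowPrimes_iff (AL_le_BL_s hS i (mem_univ _)).1).1 hp
  exact hsound hn hpr (BWin.lo_nat_of_okShape hshape h1) (BWin.hi_nat_of_okShape hshape h2) hzW hzV hzW' hzV' hzU hzU'

/-- **`ML l n · P_n ∈ ℤ`** for a sound, chain-separated list (`n ≥ 10496`). -/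
theorem ML_mul_recordP_int_s (hS : SoundList l) (hch : chainSep l = true) {n : ℕ} (hn : 10496 ≤ n) :
    ∃ z : ℤ, ML l n * recordP n = z := by
  classical
  have hn1 : 1 ≤ n := by omega
  obtain ⟨⟨zU, hzU⟩, ⟨zW, hzW⟩, ⟨zV, hzV⟩, ⟨zU', hzU'⟩, ⟨zW', hzW'⟩, ⟨zV', hzV'⟩⟩ := sharp_ints hn1
  obtain ⟨s, -, hρ⟩ := exists_sign_mul_abs _ (rhoOf_aRec_ne_zero n)
  have habs : |rhoOf (aRec n)| ≠ 0 := abs_ne_zero.2 (rhoOf_aRec_ne_zero n)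
  have hdiv : rhoOf (aRec n) / |rhoOf (aRec n)| = s := by rw [div_eq_iff habs]; exact hρ
  have key : M0 n * recordP n = (rhoOf (aRec n) / |rhoOf (aRec n)|) *
      ((dRec n ^ 3 * sharpNormaliser (bRecord' n) * coeffW (bRecord' n)) *
      (dRec n ^ 6 * sharpNormaliser (bRecord n) * coeffV (bRecord n)) -
      (dRec n ^ 3 * sharpNormaliser (bRecord n) * coeffW (bRecord n)) *
      (dRec n ^ 6 * sharpNormaliser (bRecord' n) * coeffV (bRecord' n))) := by
    unfold M0 recordP
    field_simp
  rw [hdiv, hzW, hzV, hzW', hzV'] at key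
  have hdvd : ((corrL l n : ℕ) : ℤ) ∣ (zW' * zV - zW * zV') := by
    apply multiWindowProd_dvd_int
    · intro i hi p hp
      exact ((dvdL_s hS hn hzW hzV hzW' hzV' hzU hzU') i hi p hp).1
    · exact disjointL_s hS hch n
  obtain ⟨q, hq⟩ := hdvd
  refine ⟨s * q, ?_⟩
  have hc : (corrL l n : ℚ) ≠ 0 := by exact_mod_cast (corrL_pos l n).ne'
  have e : (zW' : ℚ) * zV - zW * zV' = (corrL l n : ℚ) * q := by exact_mod_cast hq
  calc ML l n * recordP n = M0 n * recordP n / corrL l n := by unfold ML; ring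
    _ = s * ((zW' : ℚ) * zV - zW * zV') / corrL l n := by rw [key]
    _ = ((s * q : ℤ) : ℚ) := by rw [e]; push_cast; field_simp

/-- **`ML l n · Q(a·n) ∈ ℤ`** for a sound, chain-separated list (`n ≥ 10496`). -/
theorem ML_mul_recordQ_int_s (hS : SoundList l) (hch : chainSep l = true) {n : ℕ} (hn : 10496 ≤ n) :
    ∃ z : ℤ, ML l n * recordQ n = z := by
  classical
  have hn1 : 1 ≤ n := by omega
  obtain ⟨⟨zU, hzU⟩, ⟨zW, hzW⟩, ⟨zV, hzV⟩, ⟨zU', hzU'⟩, ⟨zW', hzW'⟩, ⟨zV', hzV'⟩⟩ := sharp_ints hn1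
  obtain ⟨s, -, hρ⟩ := exists_sign_mul_abs _ (rhoOf_aRec_ne_zero n)
  have habs : |rhoOf (aRec n)| ≠ 0 := abs_ne_zero.2 (rhoOf_aRec_ne_zero n)
  have hdiv : rhoOf (aRec n) / |rhoOf (aRec n)| = s := by rw [div_eq_iff habs]; exact hρ
  have hQ := recordQ_eq_wedge hn1
  have key : M0 n * recordQ n = (rhoOf (aRec n) / |rhoOf (aRec n)|) * dRec n ^ 5 *
      ((dRec n * sharpNormaliser (bRecord n) * coeffU (bRecord n)) *
      (dRec n ^ 3 * sharpNormaliser (bRecord' n) * coeffW (bRecord' n)) -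
      (dRec n * sharpNormaliser (bRecord' n) * coeffU (bRecord' n)) *
      (dRec n ^ 3 * sharpNormaliser (bRecord n) * coeffW (bRecord n))) := by
    unfold M0
    rw [hQ]
    field_simp
  rw [hdiv, hzU, hzW, hzU', hzW'] at key
  set D : ℤ := (Nat.lcmUpto (41 * n) : ℤ) with hD
  have hdvd : ((corrL l n : ℕ) : ℤ) ∣ (D ^ 5 * (zU * zW') - D ^ 5 * (zU' * zW)) := by
    apply multiWindowProd_dvd_int
    · intro i hi p hp
      exact ((dvdL_s hS hn hzW hzV hzW' hzV' hzU hzU') i hi p hp).2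
    · exact disjointL_s hS hch n
  obtain ⟨q, hq⟩ := hdvd
  refine ⟨s * q, ?_⟩
  have hc : (corrL l n : ℚ) ≠ 0 := by exact_mod_cast (corrL_pos l n).ne'
  have hDq : (D : ℚ) = dRec n := by rw [hD]; unfold dRec; push_cast; rfl
  have e : (dRec n) ^ 5 * ((zU : ℚ) * zW' - zU' * zW) = (corrL l n : ℚ) * q := by
    rw [← hDq]; exact_mod_cast (by rw [← hq]; ring : D ^ 5 * (zU * zW' - zU' * zW) = (corrL l n : ℤ) * q)
  calc ML l n * recordQ n = M0 n * recordQ n / corrL l n := by unfold ML; ring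
    _ = s * (dRec n ^ 5 * ((zU : ℚ) * zW' - zU' * zW)) / corrL l n := by rw [key]; ring
    _ = ((s * q : ℤ) : ℚ) := by rw [e]; push_cast; field_simp

/-- **Size** for a sound list: for every `ε > 0`, eventually `ML l n ≤ e^{(381.5232 − rateQ l + ε)·n}`. -/
theorem eventually_ML_le_exp_s (hS : SoundList l) {ε : ℝ} (hε : 0 < ε) :
    ∀ᶠ n : ℕ in atTop, ((ML l n : ℚ) : ℝ) ≤ Real.exp (((3815232 / 10000 - rateQ l : ℚ) + ε) * n) := by
  have hε2 : 0 < ε / 2 := by positivity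
  have hΦ := eventually_exp_le_multiWindowProd (s := (univ : Finset (Fin l.length))) (w := kL l) (AL_le_BL_s hS) hε2
  filter_upwards [eventually_M0_le_exp hε2, hΦ] with n hM0 hcorr
  rw [rate_real] at hcorr
  have hcorr' : Real.exp ((((rateQ l : ℚ) : ℝ) - ε / 2) * n) ≤ ((corrL l n : ℕ) : ℝ) := hcorr
  have hcpos : (0 : ℝ) < ((corrL l n : ℕ) : ℝ) := by exact_mod_cast corrL_pos l n
  have hcast : ((ML l n : ℚ) : ℝ) = ((M0 n : ℚ) : ℝ) / ((corrL l n : ℕ) : ℝ) := by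
    unfold ML; push_cast; rfl
  rw [hcast]
  calc ((M0 n : ℚ) : ℝ) / ((corrL l n : ℕ) : ℝ) ≤ Real.exp ((3815232 / 10000 + ε / 2) * n) / ((corrL l n : ℕ) : ℝ) :=
        div_le_div_of_nonneg_right hM0 hcpos.le
    _ ≤ Real.exp ((3815232 / 10000 + ε / 2) * n) / Real.exp ((((rateQ l : ℚ) : ℝ) - ε / 2) * n) :=
        div_le_div_of_nonneg_left (Real.exp_pos _).le (Real.exp_pos _) hcorr'
    _ = Real.exp (((3815232 / 10000 - rateQ l : ℚ) + ε) * n) := by rw [← Real.exp_sub]; push_cast; ring_nf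

/-- **THE EXPONENT OF A SOUND TABLE, hypothesis-free.**  For a sound, chain-separated list `l` and every `γ ≥ 0` with
`γ·((381.5232 − rateQ l) + 0.02 + 85.08768884) < 85.08768883 + 31.5452`: eventually `|ζ(5) − P_n/Q(a·n)| < 1/q_n^γ` with
the integers `p_n = ML l n·P_n`, `q_n = ML l n·|Q(a·n)| ≥ 1`.  No irrationality content for `γ < 1`. -/
theorem record_exponent_of_sound (hS : SoundList l) (hch : chainSep l = true) {γ : ℝ} (hγ0 : 0 ≤ γ)
    (hγ : γ * ((((3815232 / 10000 - rateQ l : ℚ) : ℝ) + 2 / 100) + 8508768884 / 10 ^ 8) <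
      8508768883 / 10 ^ 8 + 315452 / 10000) :
    ∀ᶠ n : ℕ in atTop, ∃ p : ℤ, ∃ q : ℕ, 1 ≤ q ∧ (q : ℚ) = ML l n * |(recordQ n : ℚ)| ∧ (p : ℚ) = ML l n * recordP n ∧
      |zetaValue 5 - (recordP n : ℝ) / (recordQ n : ℝ)| < 1 / (q : ℝ) ^ γ := by
  refine record_exponent_rat (lam := ((3815232 / 10000 - rateQ l : ℚ) : ℝ) + 2 / 100) (ML l) ?_ hγ0 hγ
  filter_upwards [eventually_ML_le_exp_s hS (show (0 : ℝ) < 2 / 100 by norm_num), eventually_ge_atTop 10496] with n hn hnN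
  exact ⟨ML_pos l n, ML_mul_recordP_int_s hS hch hnN, ML_mul_recordQ_int_s hS hch hnN, hn⟩

/-- **The exponent of a table checked by `ok2`.** -/
theorem record_exponent_of_table2 (hok : l.all BWin.ok2 = true) (hch : chainSep l = true) {γ : ℝ} (hγ0 : 0 ≤ γ)
    (hγ : γ * ((((3815232 / 10000 - rateQ l : ℚ) : ℝ) + 2 / 100) + 8508768884 / 10 ^ 8) <
      8508768883 / 10 ^ 8 + 315452 / 10000) :
    ∀ᶠ n : ℕ in atTop, ∃ p : ℤ, ∃ q : ℕ, 1 ≤ q ∧ (q : ℚ) = ML l n * |(recordQ n : ℚ)| ∧ (p : ℚ) = ML l n * recordP n ∧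
      |zetaValue 5 - (recordP n : ℝ) / (recordQ n : ℝ)| < 1 / (q : ℝ) ^ γ :=
  record_exponent_of_sound (soundList_of_all_ok2 hok) hch hγ0 hγ

end BrickAtlas

end Summit.KontsevichZagierPeriods.Zeta5Search.RecordRay
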